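import Literature.IUT.LogThetaLattice.FHodgeTheaterGroupoid
import Literature.IUT.LogThetaLattice.PrimeStripFrame
import Literature.IUT.HodgeTheaters.FPrimeStripsRigidity
import Mathlib.CategoryTheory.Category.ULift

/-!
# `StripFrame.ofKits`: the [IUTchIII] §1–§2 prime-strip / Hodge-theater frame ASSEMBLED from the [IUTchI] kits (MERGE-MAP B10 part 2)

Mochizuki, *Inter-universal Teichmüller Theory III*, kurims manuscript (May 2020), Def 1.1 p. 23, Prop 1.3
p. 42, Rmk 1.3.1 p. 43; *I* (May 2020), Def 4.1 (iv) p. 96, Def 5.2 (i)–(iv) pp. 134–135, Rmk 5.2.1 p. 143,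
Cor 5.3 (ii)(iii) p. 144, Def 6.11 (iii) p. 173; *II* (Dec 2020), Def 4.9 (vi)–(viii) pp. 157–158.
([IUTchIII] Def 1.1 p.23) [claim: Mochizuki2012, status: disputed]. MERGE BRIDGE plan/L6/MERGE-MAP.md §8 B10 part 2
(row 46 `realFrame : StripFrame`), consumer seat abc-iut-L6-t3. Nothing of the series is asserted.

`Literature.IUT.LogThetaLattice.StripFrame` (`PrimeStripFrame.lean`, this seat, gen 0) is the single-universe
INTERFACE over which every [IUTchIII] §1–§2 statement is typed (log-links, Prop 1.2/1.3, Def 1.4, Thm 1.5, Prop 2.1,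
Thm 2.2, Cor 2.3; consumed by the Cor 3.12 crew: `Summit.ABC.IUTFork.Thm311.LinkData.ofGlue`, `Cor312.Setting`'s
`lat`). This file builds a `StripFrame` from the LANDED kit-level typings of [IUTchI] §4–§6:

* [IUTchI] §4–5 half — abc-iut-L5-t4's `PMBaseKit K`, `MultKit M`, `FKit FK` (FPrimeStrips) + abc-iut-L5-d4's
  `FKit.MonoLaws L` + abc-iut-L6-t7's groupoids and functors (`PrimeStripGroupoids`: `assocDFunctor`, `monoFunctor`,
  `rlfFmFunctor`, `assocDmFunctor L`, `monoDFunctor L`, `toDvComm L`) — the fields `F`, `Fv`, `Fgl`, `D`, `Dv`, `toD`,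
  `toFv`, `FvToDv`, `DToDv`, `FglToFv`, `toDv_comm`;
* RIGIDITY — the frame's fields `toD_isoBij` ([IUTchI] Cor 5.3 (ii)) and `toDv_isoSurj` (Cor 5.3 (iii)) are abc-iut-L5-t4's
  NAMED statements `FKit.IsomFtoDBijective`, `FKit.IsomFmtoDmSurjective`, taken as HYPOTHESES `hbij`, `hsurj` and
  transferred by L6-t7's `toD_isoBij_iff` / `toDv_isoSurj_iff` (neither is asserted here);
* [IUTchI] §6 half — this seat's representative-level groupoids `HTRep FK` (`Θ^{±ell}`-Hodge theaters,
  `FHodgeTheaterGroupoid`) and `DHTRep K` (`𝒟-Θ^{±ell}`-Hodge theaters, `DHodgeTheaterGroupoid`) with `toDFunctor`,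
  `codFunctor` (`†ℋ𝒯 ↦ †𝔉_≻`), `stripComm` — the fields `HT`, `DHT`, `htToD`, `strip`, `dstrip`, `strip_comm`,
  `iso_nonempty_DHT`. DISCLOSED TRUNCATIONS: (1) `Label := PUnit` = the label `≻` only (the Ξ-INVARIANT label used by
  this seat's §1 files; the capsule labels `t ∈ T` move under the `𝔽_l^{⋊±}`-symmetry and are not functorial in `Ξ`,
  the label `>` is identified with `≻` along the gluing of [IUTchI] Rmk 6.12.2 (i)); (2) `HT` is the `Θ^{±ell}`-Hodge
  theater [Def 6.11 (iii)]: the ΘNF half of a `Θ^{±ell}NF`-Hodge theater [Def 6.13 (i)] (abc-iut-L5-t4's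
  `S5Local.ThetaPMEllNFHT`, itself over the hypothesis kit `S5Local` of abc-iut-L5-t3's ΘNF-Hodge theaters) is reached
  from it by the forgetful map `ThetaPMEllNFHT.pmEll` and enters [IUTchIII] §1–2 only through `>`/`≻` and the
  [IUTchII] §4 data of the next item;
* [IUTchII] Def 4.9 (vi)–(viii) half — the `F^{⊢×μ}`-, `F^{⊢▶×μ}`-, `F^{⊩▶×μ}`-prime-strip categories and the functors
  between them are an explicit INPUT `TimesMuSide` (instantiated by abc-iut-L6-t2's `KummerPrimeStripCategories` /
  `RealifiedPrimeStripCategories`: `FTimesMuPrimeStrip`, `FTriMuPrimeStrip`, `FVdashTriMuPrimeStripF`,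
  `toTimesMuFunctor`, `toStripFunctor`, together with the passages `F^⊢ ↦ F^{⊢×μ}`, `F^{⊢×μ} ↦ D^⊢`, `F^⊩ ↦ F^{⊩▶×μ}`
  that couple L5-t4's and L6-t2's kits — cross data no landed module owns yet).

UNIVERSES. abc-iut-L5-t4's Hodge-theater records carry an index type `T : Type`, so `HTRep FK`, `DHTRep K` live in
`Type (max 1 u)` with morphisms in `Type u`, while `StripFrame.{w}` is single-universe ("instantiate large categories via
`ULift`/`ULiftHom` if needed", its docstring). Accordingly `StripFrame.ofKits : StripFrame.{max 1 u}` and EVERY category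
is wrapped in Mathlib's `AsSmall.{max 1 u}` (equivalent to the original via `AsSmall.equiv`); functors are transported as
`AsSmall.down ⋙ Φ ⋙ AsSmall.up` (`liftF`), natural isomorphisms and the rigidity / connectedness fields along the
equivalence (`§ Transport`).
-/

namespace Literature.IUT.LogThetaLattice

open CategoryTheory
open Literature.IUT.HodgeTheaters Literature.IUT.HodgeTheaters.PMBaseKit

universe w v v' u u'

/-! ### Transport along `AsSmall` -/

namespace AsSmallTransport

variable {C : Type u} [Category.{v} C] {D : Type u'} [Category.{v'} D]

/-- **IUTchIII:Def1.1** (kurims p.23) A functor transported to the small models `AsSmall` ("instantiate large categories via `ULift`",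
`PrimeStripFrame` docstring). ([IUTchIII] Def 1.1 p.23) [claim: Mochizuki2012, status: disputed] -/
abbrev liftF (Φ : C ⥤ D) : AsSmall.{w} C ⥤ AsSmall.{w} D := AsSmall.down ⋙ Φ ⋙ AsSmall.up

/-- **IUTchIII:Def1.1** (kurims p.23) Isomorphisms in `AsSmall C` are isomorphisms in `C` (the equivalence `AsSmall.equiv` is an
isomorphism of categories). ([IUTchIII] Def 1.1 p.23) [claim: Mochizuki2012, status: disputed] -/
def isoEquiv (X Y : AsSmall.{w} C) : (X ≅ Y) ≃ (ULift.down X ≅ ULift.down Y) where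
  toFun f := AsSmall.down.mapIso f
  invFun g := AsSmall.up.mapIso g
  left_inv _ := Iso.ext rfl
  right_inv _ := Iso.ext rfl

/-- **IUTchIII:Def1.1** (kurims p.23) `liftF Φ` on isomorphisms is `Φ.mapIso` conjugated by `isoEquiv`.
([IUTchIII] Def 1.1 p.23) [claim: Mochizuki2012, status: disputed] -/
theorem liftF_mapIso_eq (Φ : C ⥤ D) (X Y : AsSmall.{w} C) :
    (fun f : X ≅ Y => (liftF Φ).mapIso f) =
      (isoEquiv _ _).symm ∘ (fun g : ULift.down X ≅ ULift.down Y => Φ.mapIso g) ∘ isoEquiv X Y := by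
  funext f
  exact Iso.ext rfl

/-- **IUTchI:Cor5.3(ii)** (kurims p.144) Bijectivity of `mapIso` on isomorphisms transfers to the small models.
([IUTchI] Cor 5.3 (ii) p.144) [claim: Mochizuki2012, status: disputed] -/
theorem liftF_mapIso_bijective (Φ : C ⥤ D)
    (h : ∀ X Y : C, Function.Bijective (fun g : X ≅ Y => Φ.mapIso g)) (X Y : AsSmall.{w} C) :
    Function.Bijective (fun f : X ≅ Y => (liftF Φ).mapIso f) := by
  rw [liftF_mapIso_eq]
  exact (isoEquiv _ _).symm.bijective.comp ((h _ _).comp (isoEquiv X Y).bijective)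

/-- **IUTchI:Cor5.3(iii)** (kurims p.144) Surjectivity of `mapIso` on isomorphisms transfers to the small models.
([IUTchI] Cor 5.3 (iii) p.144) [claim: Mochizuki2012, status: disputed] -/
theorem liftF_mapIso_surjective (Φ : C ⥤ D)
    (h : ∀ X Y : C, Function.Surjective (fun g : X ≅ Y => Φ.mapIso g)) (X Y : AsSmall.{w} C) :
    Function.Surjective (fun f : X ≅ Y => (liftF Φ).mapIso f) := by
  rw [liftF_mapIso_eq]
  exact (isoEquiv _ _).symm.surjective.comp ((h _ _).comp (isoEquiv X Y).surjective)

/-- **IUTchI:Cor5.3(iii)** (kurims p.144) Surjectivity of `mapIso` on the isomorphisms between two GIVEN objects transfers to the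
small models (pointwise form, for the [IUTchII] Cor 4.10 (iv) "not full / coincides with the full poly-isomorphism"
clauses stated object by object). ([IUTchI] Cor 5.3 (iii) p.144) [claim: Mochizuki2012, status: disputed] -/
theorem liftF_mapIso_surjective_at (Φ : C ⥤ D) (X Y : AsSmall.{w} C)
    (h : Function.Surjective (fun g : ULift.down X ≅ ULift.down Y => Φ.mapIso g)) :
    Function.Surjective (fun f : X ≅ Y => (liftF Φ).mapIso f) := by
  rw [liftF_mapIso_eq]
  exact (isoEquiv _ _).symm.surjective.comp (h.comp (isoEquiv X Y).surjective)

/-- **IUTchIII:Def1.1** (kurims p.23) A natural isomorphism `Φ ≅ Ψ` transported to the small models.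
([IUTchIII] Def 1.1 p.23) [claim: Mochizuki2012, status: disputed] -/
def liftNatIso {Φ Ψ : C ⥤ D} (e : Φ ≅ Ψ) : liftF.{w} Φ ≅ liftF.{w} Ψ :=
  NatIso.ofComponents (fun X => AsSmall.up.mapIso (e.app (ULift.down X))) (fun f => ULift.ext _ _ (e.hom.naturality f.down))

/-- **IUTchI:Def5.2(i)** (kurims p.134) Connectedness ("any two prime-strips are isomorphic") transfers to the small models.
([IUTchI] Def 5.2 (i) p.134) [claim: Mochizuki2012, status: disputed] -/
theorem iso_nonempty_lift (h : ∀ X Y : C, Nonempty (X ≅ Y)) (X Y : AsSmall.{w} C) : Nonempty (X ≅ Y) :=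
  ⟨(isoEquiv X Y).symm (h _ _).some⟩

/-- **IUTchI:Def5.2(iii)** (kurims p.134) The small model of a groupoid is a groupoid ("morphisms = collections of isomorphisms").
([IUTchI] Def 5.2 (iii) p.134) [claim: Mochizuki2012, status: disputed] -/
instance isGroupoid_asSmall [IsGroupoid C] : IsGroupoid (AsSmall.{w} C) where
  all_isIso f := ⟨⟨⟨inv f.down⟩, ULift.ext _ _ (IsIso.hom_inv_id f.down), ULift.ext _ _ (IsIso.inv_hom_id f.down)⟩⟩

variable {E : Type*} [Category E] {E' : Type*} [Category E']

/-- **IUTchIII:Def1.1** (kurims p.23) A commuting isomorphism of composites `Φ ⋙ Ψ ≅ Φ' ⋙ Ψ'` transported to the small models.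
([IUTchIII] Def 1.1 p.23) [claim: Mochizuki2012, status: disputed] -/
def liftSquare {Φ : C ⥤ D} {Ψ : D ⥤ E} {Φ' : C ⥤ E'} {Ψ' : E' ⥤ E} (e : Φ ⋙ Ψ ≅ Φ' ⋙ Ψ') :
    liftF.{w} Φ ⋙ liftF Ψ ≅ liftF.{w} Φ' ⋙ liftF Ψ' :=
  NatIso.ofComponents (fun X => AsSmall.up.mapIso (e.app (ULift.down X))) (fun f => ULift.ext _ _ (e.hom.naturality f.down))

/-- **IUTchIII:Def1.1** (kurims p.23) A commuting isomorphism `Φ ⋙ Ψ ≅ Θ` transported to the small models.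
([IUTchIII] Def 1.1 p.23) [claim: Mochizuki2012, status: disputed] -/
def liftTriangle {Φ : C ⥤ D} {Ψ : D ⥤ E} {Θ : C ⥤ E} (e : Φ ⋙ Ψ ≅ Θ) :
    liftF.{w} Φ ⋙ liftF Ψ ≅ liftF.{w} Θ :=
  NatIso.ofComponents (fun X => AsSmall.up.mapIso (e.app (ULift.down X))) (fun f => ULift.ext _ _ (e.hom.naturality f.down))

end AsSmallTransport

open AsSmallTransport

variable {l : ℕ} {K : PMBaseKit.{u} l} {M : K.MultKit}

/-! ### The [IUTchII] Def 4.9 input -/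

/-- **IUTchII:Def4.9(vii)** (kurims p.158) INPUT for the assembly: the categories of `F^{⊢×μ}`-, `F^{⊢▶×μ}`- [IUTchII, Def 4.9 (vii)]
and `F^{⊩▶×μ}`-prime-strips [Def 4.9 (viii)] ("morphisms = collections of isomorphisms") with the functors
`F^⊢ ↦ F^{⊢×μ}` [Def 4.9 (vi)(vii)], `F^{⊢×μ} ↦ D^⊢` [Def 4.9 (vii)], `F^⊩ ↦ F^{⊩▶×μ} ↦ F^{⊢▶×μ} ↦ F^{⊢×μ}` [Def 4.9 (viii), (vi)]
over abc-iut-L5-t4's kits, the compatibility `F^⊢ → F^{⊢×μ} → D^⊢ = F^⊢ → D^⊢`, and connectedness. Instantiated by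
abc-iut-L6-t2's `KummerPrimeStripCategories` / `RealifiedPrimeStripCategories` (`FTimesMuPrimeStrip`,
`FTriMuPrimeStrip`, `FVdashTriMuPrimeStripF`, `toTimesMuFunctor`, `toStripFunctor`) together with the cross passages
between the two kits (owner abc-iut-L6-t2 / abc-iut-L5; TODO-merge). ([IUTchII] Def 4.9 (vii) p.158) [claim: Mochizuki2012, status: disputed] -/
structure TimesMuSide (FK : K.FKit M) (L : FK.MonoLaws) : Type (u + 1) where
  /-- `F^{⊢×μ}`-prime-strips [IUTchII, Def 4.9 (vii)] -/
  Fxm : Type u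
  [catFxm : Category.{u} Fxm]
  [grpFxm : IsGroupoid Fxm]
  /-- `F^{⊢▶×μ}`-prime-strips [IUTchII, Def 4.9 (vii)] -/
  Fvtxm : Type u
  [catFvtxm : Category.{u} Fvtxm]
  [grpFvtxm : IsGroupoid Fvtxm]
  /-- `F^{⊩▶×μ}`-prime-strips [IUTchII, Def 4.9 (viii)] -/
  Fglxm : Type u
  [catFglxm : Category.{u} Fglxm]
  [grpFglxm : IsGroupoid Fglxm]
  /-- `F^⊢ ↦ F^{⊢×μ}` [IUTchII, Def 4.9 (vi)(vii)] on abc-iut-L5-t4's `ℱ^⊢`-prime-strips -/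
  FvToFxm : FK.FmStrip ⥤ Fxm
  /-- `F^{⊢×μ} ↦ D^⊢` [IUTchII, Def 4.9 (vii)] into abc-iut-L5-t4's `𝒟^⊢`-prime-strips -/
  FxmToDv : Fxm ⥤ M.DMono
  /-- `F^⊩ ↦ F^{⊩▶×μ}` [IUTchII, Def 4.9 (viii)] on abc-iut-L5-t4's `ℱ^⊩`-prime-strips -/
  FglToFglxm : FK.FrStrip ⥤ Fglxm
  /-- `F^{⊩▶×μ} ↦ F^{⊢▶×μ}` [IUTchII, Def 4.9 (viii)] -/
  FglxmToFvtxm : Fglxm ⥤ Fvtxm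
  /-- `F^{⊢▶×μ} ↦ F^{⊢×μ}` [IUTchII, Def 4.9 (vi)(vii)] -/
  FvtxmToFxm : Fvtxm ⥤ Fxm
  /-- `F^⊢ → F^{⊢×μ} → D^⊢ = F^⊢ → D^⊢` [IUTchII, Def 4.9 (vii)] (the `𝒟^⊢`-prime-strip is unchanged) -/
  fxm_comm : FvToFxm ⋙ FxmToDv ≅ PrimeStripGroupoids.assocDmFunctor L
  /-- any two `F^{⊢×μ}`-prime-strips are isomorphic [Def 4.9 (vii): "isomorphic to `‡F^{⊢×μ}_v`"] -/
  iso_nonempty_Fxm : ∀ X Y : Fxm, Nonempty (X ≅ Y)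
  /-- any two `F^{⊩▶×μ}`-prime-strips are isomorphic [Def 4.9 (viii)] -/
  iso_nonempty_Fglxm : ∀ X Y : Fglxm, Nonempty (X ≅ Y)

attribute [instance] TimesMuSide.catFxm TimesMuSide.grpFxm TimesMuSide.catFvtxm TimesMuSide.grpFvtxm
  TimesMuSide.catFglxm TimesMuSide.grpFglxm

/-! ### The assembly -/

section

variable {FK : K.FKit M} (L : FK.MonoLaws) (hbij : FK.IsomFtoDBijective) (hsurj : FK.IsomFmtoDmSurjective)
  (hR : FK.RlfOfIsStrip) (X : TimesMuSide FK L)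

/-- **IUTchIII:Def1.1** (kurims p.23) **`StripFrame.ofKits`** — the prime-strip / Hodge-theater frame of [IUTchIII] §1–§2 ASSEMBLED
from the [IUTchI] kits (abc-iut-L5-t4 `PMBaseKit`/`MultKit`/`FKit`, abc-iut-L5-d4 `MonoLaws`, abc-iut-L6-t7
`PrimeStripGroupoids`), this seat's representative-level Hodge-theater groupoids (`HTRep`, `DHTRep`), the [IUTchII] Def 4.9
input `TimesMuSide`, and abc-iut-L5-t4's NAMED rigidity statements [IUTchI] Cor 5.3 (ii)(iii) as hypotheses; every
category wrapped in `AsSmall.{max 1 u}` (see the module docstring: UNIVERSES, DISCLOSED TRUNCATIONS).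
([IUTchIII] Def 1.1 p.23) [claim: Mochizuki2012, status: disputed] -/
noncomputable def StripFrame.ofKits : StripFrame.{max 1 u} :=
  { F := AsSmall.{max 1 u} FK.FStrip
    Fv := AsSmall.{max 1 u} FK.FmStrip
    Fxm := AsSmall.{max 1 u} X.Fxm
    Fvtxm := AsSmall.{max 1 u} X.Fvtxm
    Fgl := AsSmall.{max 1 u} FK.FrStrip
    Fglxm := AsSmall.{max 1 u} X.Fglxm
    D := AsSmall.{max 1 u} K.DStrip
    Dv := AsSmall.{max 1 u} M.DMono
    HT := AsSmall.{max 1 u} (HTRep FK)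
    DHT := AsSmall.{max 1 u} (DHTRep K)
    toD := liftF (PrimeStripGroupoids.assocDFunctor FK)
    toFv := liftF (PrimeStripGroupoids.monoFunctor FK)
    FvToDv := liftF (PrimeStripGroupoids.assocDmFunctor L)
    DToDv := liftF (PrimeStripGroupoids.monoDFunctor L)
    FvToFxm := liftF X.FvToFxm
    FxmToDv := liftF X.FxmToDv
    FglToFv := liftF (PrimeStripGroupoids.rlfFmFunctor FK
      (FKit.nonempty_rlfFm_rlfModel_iso_of_rlfOfIsStrip hR))
    FglToFglxm := liftF X.FglToFglxm
    FglxmToFvtxm := liftF X.FglxmToFvtxm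
    FvtxmToFxm := liftF X.FvtxmToFxm
    toDv_comm := liftSquare (PrimeStripGroupoids.toDvComm L)
    fxm_comm := liftTriangle X.fxm_comm
    htToD := liftF HTRep.toDFunctor
    Label := PUnit
    strip := fun _ => liftF HTRep.codFunctor
    dstrip := fun _ => liftF DHTRep.codFunctor
    strip_comm := fun _ => liftSquare HTRep.stripComm
    toD_isoBij := liftF_mapIso_bijective _ (PrimeStripGroupoids.toD_isoBij_iff.2 hbij)
    toDv_isoSurj := liftF_mapIso_surjective _ ((PrimeStripGroupoids.toDv_isoSurj_iff L).2 hsurj)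
    iso_nonempty_F := iso_nonempty_lift PrimeStripGroupoids.iso_nonempty_FStrip
    iso_nonempty_Fxm := iso_nonempty_lift X.iso_nonempty_Fxm
    iso_nonempty_Fglxm := iso_nonempty_lift X.iso_nonempty_Fglxm
    iso_nonempty_DHT := iso_nonempty_lift DHTRep.iso_nonempty }

/-- **IUTchIII:Def1.1** (kurims p.23) The `F`-prime-strips of the assembled frame ARE (the small models of) abc-iut-L5-t4's
`ℱ`-prime-strips. ([IUTchIII] Def 1.1 p.23) [claim: Mochizuki2012, status: disputed] -/
theorem StripFrame.ofKits_F : (StripFrame.ofKits L hbij hsurj hR X).F = AsSmall.{max 1 u} FK.FStrip := rfl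

/-- **IUTchIII:Prop1.3(i)** (kurims p.42) The Hodge theaters of the assembled frame ARE (the small models of) the representative-level
groupoid of `Θ^{±ell}`-Hodge theaters over abc-iut-L5-t4's `FKit.ThetaPMEllHT`. ([IUTchIII] Prop 1.3 (i) p.42) [claim: Mochizuki2012, status: disputed] -/
theorem StripFrame.ofKits_HT : (StripFrame.ofKits L hbij hsurj hR X).HT = AsSmall.{max 1 u} (HTRep FK) := rfl

/-- **IUTchIII:Prop1.3(i)** (kurims p.42) … and its `𝒟`-Hodge theaters ARE (the small models of) `DHTRep K`.
([IUTchIII] Prop 1.3 (i) p.42) [claim: Mochizuki2012, status: disputed] -/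
theorem StripFrame.ofKits_DHT : (StripFrame.ofKits L hbij hsurj hR X).DHT = AsSmall.{max 1 u} (DHTRep K) := rfl

end

end Literature.IUT.LogThetaLattice
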